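import Literature.Analysis.Complex.FourierPolyaKiKimGenusZero
import Literature.Analysis.Complex.LaguerrePolya
import Mathlib.Analysis.Calculus.Deriv.Star
import Mathlib.Analysis.SpecialFunctions.Pow.Deriv
import HarnessLib

/-!
# Ki–Kim 2000, Theorem 4.3 (no critical points, `α = 0`, even `f`): the discharge

This file proves `Literature.Analysis.Complex.KiKim2000_thm_4_3_noCriticalPoints_holds`, the
discharge of the named fact `Literature.Analysis.Complex.KiKim2000_thm_4_3_noCriticalPoints`
(`Literature/Analysis/Complex/FourierPolyaKiKim.lean`): an even real entire function `f ≢ 0` of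
order `< 2` whose real restriction has no Fourier critical point has only real zeros
(H. Ki, Y.-O. Kim, Duke Math. J. 104 (2000), Theorem 4.3 with `K = 0`, pp. 63–65).

## The proof (following the printed one, pp. 63–65)

* Step 0 (`exists_eq_pow_mul_of_entire`, `noCrit_of_noCrit_pow_mul`): write `f = z^m f₁` with
  `f₁(0) ≠ 0`; `H` passes from `f|ℝ` to `f₁|ℝ` (Ki–Kim Thm 3.2, Corollary: division by `x`,
  `noCrit_of_noCrit_id_mul` of the transfer file), `f₁` is again even, real, of order `< 2`.
* Step 1 (`differentiable_comp_cpow_half`): `G(w) = f₁(w^{1/2})` is entire (evenness), real on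
  `ℝ`, of order `< 1`, and `G(z²) = f₁(z)`.
* Step 2 (`hasDerivAt_gammaChain`, `noCrit_gammaChain`, `noCrit_re_of_gammaChain`): with
  `γₙ(t) = Re G^{(n)}(t²)` one has `γₙ' = 2t γₙ₊₁`, so `H` descends along the chain from
  `γ₀ = Re f₁|ℝ` (Ki–Kim p. 64); at `t = 0` and on `(-∞, 0)` no `G^{(n)}` vanishes
  ((4.12): the signs of `G^{(n)}(0)` alternate strictly, `re_iteratedDeriv_zero_mul_succ_neg`,
  `re_iteratedDeriv_ne_zero_of_neg`), whence `H(Re G|ℝ)`.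
* Step 3: the Fourier–Pólya theorem for order `< 1` and no critical points
  (`im_eq_zero_of_noCrit_of_order_lt_one`, file `FourierPolyaKiKimGenusZero`, Ki–Kim Thm 4.1 with
  `K = 0`) gives that all zeros of `G` are real; by (4.12) they are positive, so the zeros
  `z` of `f₁` (i.e. `G(z²) = 0`) have `z² > 0`, i.e. are real.

## References

* H. Ki, Y.-O. Kim, *On the number of nonreal zeros of real entire functions and the
  Fourier–Pólya conjecture*, Duke Math. J. 104 (2000) 45–73, Theorem 4.3 and its proof
  pp. 63–65 [KiKim2000].
-/

noncomputable section

open Filter Set Topology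
open scoped Topology

namespace Literature.Analysis.Complex
namespace KiKim



section reduction

open _root_.Complex Literature.Analysis.TotalPositivity
open scoped ComplexConjugate

/-! ## Square roots and the function `G` with `G(z²) = f(z)`

(Schwarz reflection `apply_conj_eq_conj` is taken from `LaguerrePolya.lean`.) -/

/-- The principal square root squares to the identity. [folklore] -/
theorem cpow_half_sq (w : ℂ) : (w ^ ((2:ℂ)⁻¹)) ^ 2 = w := by
  simp

/-- `‖w^{1/2}‖ = ‖w‖^{1/2}`. [folklore] -/
theorem norm_cpow_half (w : ℂ) : ‖w ^ ((2:ℂ)⁻¹)‖ = ‖w‖ ^ ((2:ℝ)⁻¹) := by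
  have := Complex.norm_cpow_real w (2⁻¹)
  push_cast at this
  exact this

/-- An even function takes the same value at the two square roots. [folklore] -/
theorem even_apply_eq_of_sq_eq {f : ℂ → ℂ} (heven : ∀ z, f (-z) = f z) {s z : ℂ}
    (h : s ^ 2 = z ^ 2) : f s = f z := by
  rcases sq_eq_sq_iff_eq_or_eq_neg.mp h with h | h
  · rw [h]
  · rw [h, heven]

/-- **The function `G(w) = f(w^{1/2})` of an even entire `f` is entire, and `G(z²) = f(z)`**
(Ki–Kim 2000, proof of Thm 4.3: "`g(x) = G(x²)`"). Off the origin `G` is locally `f` composed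
with a holomorphic branch of the square root; at the origin the singularity is removable.
[cite: KiKim2000, Theorem 4.3 (proof)] -/
theorem differentiable_comp_cpow_half {f : ℂ → ℂ} (hf : Differentiable ℂ f) (heven : ∀ z, f (-z) = f z) :
    Differentiable ℂ (fun w => f (w ^ ((2:ℂ)⁻¹))) ∧ ∀ z, (fun w => f (w ^ ((2:ℂ)⁻¹))) (z ^ 2) = f z := by
  have hsq : ∀ z, (fun w => f (w ^ ((2:ℂ)⁻¹))) (z ^ 2) = f z := fun z =>
    even_apply_eq_of_sq_eq heven (by rw [cpow_half_sq])
  refine ⟨?_, hsq⟩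
  -- differentiability off the origin
  have hne : ∀ w : ℂ, w ≠ 0 → DifferentiableAt ℂ (fun w => f (w ^ ((2:ℂ)⁻¹))) w := by
    intro w hw
    by_cases hs : w ∈ slitPlane
    · exact (hf _).comp w (differentiableAt_id.cpow (differentiableAt_const _) hs)
    · have hns : -w ∈ slitPlane := by
        rw [Complex.mem_slitPlane_iff] at hs ⊢
        push Not at hs
        left
        have hre : w.re ≠ 0 := fun h0 => hw (Complex.ext h0 hs.2)
        have : w.re < 0 := lt_of_le_of_ne hs.1 hre
        simpa using this
      have heq : (fun w => f (w ^ ((2:ℂ)⁻¹))) = fun w => f (I * (-w) ^ ((2:ℂ)⁻¹)) := by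
        funext u
        apply even_apply_eq_of_sq_eq heven
        rw [cpow_half_sq, mul_pow, Complex.I_sq, cpow_half_sq]; ring
      rw [heq]
      refine (hf _).comp w ?_
      exact ((differentiableAt_id.neg.cpow (differentiableAt_const _) (by simpa using hns)).const_mul I)
  intro w₀
  by_cases hw₀ : w₀ = 0
  · subst hw₀
    refine (Complex.analyticAt_of_differentiable_on_punctured_nhds_of_continuousAt ?_ ?_).differentiableAt
    · exact eventually_nhdsWithin_of_forall fun w hw => hne w hw
    · have h1 : ContinuousAt (fun w : ℂ => w ^ ((2:ℂ)⁻¹)) 0 := by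
        have h2 := Complex.continuousAt_cpow_zero_of_re_pos (z := (2:ℂ)⁻¹) (by norm_num)
        exact h2.comp (f := fun w : ℂ => (w, (2:ℂ)⁻¹)) (continuousAt_id.prodMk continuousAt_const)
      exact (hf.continuous.continuousAt).comp (f := fun w : ℂ => w ^ ((2:ℂ)⁻¹)) h1
  · exact hne w₀ hw₀

/-! ## Dividing out the zero at the origin -/

/-- Division by the order of vanishing at the origin: `f = z^m f₁` with `f₁` entire,
`f₁(0) ≠ 0`. [folklore] -/
theorem exists_eq_pow_mul_of_entire {f : ℂ → ℂ} (hf : Differentiable ℂ f) (hne : ∃ z, f z ≠ 0) :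
    ∃ (m : ℕ) (f₁ : ℂ → ℂ), Differentiable ℂ f₁ ∧ f₁ 0 ≠ 0 ∧ ∀ z, f z = z ^ m * f₁ z := by
  classical
  have hA : AnalyticAt ℂ f 0 := hf.analyticAt 0
  have htop : analyticOrderAt f 0 ≠ ⊤ := by
    intro h
    obtain ⟨z, hz⟩ := hne
    apply hz
    have h2 := analyticOrderAt_eq_top.mp h
    exact (hf.differentiableOn.analyticOnNhd isOpen_univ).eqOn_zero_of_preconnected_of_eventuallyEq_zero
      isPreconnected_univ (Set.mem_univ 0) h2 (Set.mem_univ z)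
  obtain ⟨m, hm⟩ := ENat.ne_top_iff_exists.mp htop
  obtain ⟨g, hg, hg0, hfg⟩ := hA.analyticOrderAt_eq_natCast.mp hm.symm
  set f₁ : ℂ → ℂ := fun z => if z = 0 then g 0 else f z / z ^ m with hf₁
  have hloc : f₁ =ᶠ[𝓝 0] g := by
    filter_upwards [hfg] with z hz
    simp only [hf₁]
    split_ifs with h0
    · rw [h0]
    · rw [hz, smul_eq_mul, sub_zero, mul_div_cancel_left₀ _ (pow_ne_zero m h0)]
  refine ⟨m, f₁, ?_, by simp [hf₁, hg0], ?_⟩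
  · intro z
    by_cases hz : z = 0
    · subst hz
      exact (hg.congr hloc.symm).differentiableAt
    · have : f₁ =ᶠ[𝓝 z] fun w => f w / w ^ m := by
        filter_upwards [isOpen_ne.mem_nhds hz] with w hw
        simp only [hf₁, if_neg hw]
      refine (DifferentiableAt.congr_of_eventuallyEq ?_ this)
      exact (hf z).div (differentiableAt_pow m) (pow_ne_zero m hz)
  · intro z
    by_cases hz : z = 0
    · subst hz
      have h1 := hfg.self_of_nhds
      simp only [sub_zero, smul_eq_mul] at h1
      simp only [hf₁, if_true]
      rcases m with _ | m
      · simpa using h1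
      · simp [h1]
    · simp only [hf₁, if_neg hz]
      rw [mul_div_cancel₀ _ (pow_ne_zero m hz)]

/-- `H` passes through division by `t^m`. [cite: KiKim2000, Corollary to Theorem 3.2] -/
theorem noCrit_of_noCrit_pow_mul {ψ : ℝ → ℝ} (hψ : ∀ x, AnalyticAt ℝ ψ x) (m : ℕ)
    (h : HasNoFourierCriticalPoint (fun t => t ^ m * ψ t)) : HasNoFourierCriticalPoint ψ := by
  induction m generalizing ψ with
  | zero => simpa using h
  | succ m ih =>
    have h1 : HasNoFourierCriticalPoint (fun t => t * (t ^ m * ψ t)) := by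
      convert h using 2 with t; ring
    have ha : ∀ x, AnalyticAt ℝ (fun t => t ^ m * ψ t) x := fun x => by
      have := hψ x; fun_prop
    exact ih hψ (noCrit_of_noCrit_id_mul ha h1)

/-! ## The chain `γₙ(t) = Re G^{(n)}(t²)` and `H(G)` -/

/-- The real functions `γₙ(t) = Re G^{(n)}(t²)` and their derivatives:
`γₙ' = 2t γₙ₊₁`. [cite: KiKim2000, Theorem 4.3 (proof, p. 64)] -/
theorem hasDerivAt_gammaChain {G : ℂ → ℂ} (hG : Differentiable ℂ G) (n : ℕ) (t : ℝ) :
    HasDerivAt (fun s : ℝ => (iteratedDeriv n G ((s:ℂ) ^ 2)).re)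
      (2 * t * (iteratedDeriv (n + 1) G ((t:ℂ) ^ 2)).re) t := by
  have hD : Differentiable ℂ (iteratedDeriv n G) := differentiable_iteratedDeriv hG n
  have hE : Differentiable ℂ (fun w => iteratedDeriv n G (w ^ 2)) := hD.comp (differentiable_pow 2)
  have h1 := hasDerivAt_re_ofReal (f := fun w => iteratedDeriv n G (w ^ 2)) (hE.differentiableAt (x := (t:ℂ)))
  have h2 : deriv (fun w => iteratedDeriv n G (w ^ 2)) (t : ℂ) = iteratedDeriv (n + 1) G ((t:ℂ) ^ 2) * (2 * t) := by
    have := ((hD ((t:ℂ) ^ 2)).hasDerivAt.comp (t : ℂ) (hasDerivAt_pow 2 (t:ℂ))).deriv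
    rw [show (iteratedDeriv n G ∘ fun w : ℂ => w ^ 2) = fun w => iteratedDeriv n G (w ^ 2) from rfl] at this
    rw [this, ← iteratedDeriv_succ]
    push_cast; ring
  rw [h2] at h1
  have h3 : (iteratedDeriv (n + 1) G ((t:ℂ) ^ 2) * (2 * (t:ℂ))).re =
      2 * t * (iteratedDeriv (n + 1) G ((t:ℂ) ^ 2)).re := by
    rw [show (2 : ℂ) * (t : ℂ) = ((2 * t : ℝ) : ℂ) by push_cast; ring, Complex.mul_re,
      Complex.ofReal_re, Complex.ofReal_im, mul_zero, sub_zero]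
    ring
  rwa [h3] at h1

/-- All `γₙ` inherit `H` from `γ₀ = g`. [cite: KiKim2000, Theorem 4.3 (proof, pp. 64–65)] -/
theorem noCrit_gammaChain {G : ℂ → ℂ} (hG : Differentiable ℂ G)
    (hH : HasNoFourierCriticalPoint (fun s : ℝ => (G ((s:ℂ) ^ 2)).re)) (n : ℕ) :
    HasNoFourierCriticalPoint (fun s : ℝ => (iteratedDeriv n G ((s:ℂ) ^ 2)).re) := by
  induction n with
  | zero => simpa using hH
  | succ n ih =>
    have hDn : Differentiable ℂ (iteratedDeriv (n + 1) G) := differentiable_iteratedDeriv hG (n + 1)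
    have han : ∀ x, AnalyticAt ℝ (fun s : ℝ => (iteratedDeriv (n + 1) G ((s:ℂ) ^ 2)).re) x := fun x =>
      analyticAt_re_ofReal (f := fun w => iteratedDeriv (n + 1) G (w ^ 2)) (hDn.comp (differentiable_pow 2)) x
    have hderiv : deriv (fun s : ℝ => (iteratedDeriv n G ((s:ℂ) ^ 2)).re) =
        fun t : ℝ => t * (2 * (iteratedDeriv (n + 1) G ((t:ℂ) ^ 2)).re) := by
      funext t; rw [(hasDerivAt_gammaChain hG n t).deriv]; ring
    have h1 := noCrit_deriv ih
    rw [hderiv] at h1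
    have h2 := noCrit_of_noCrit_id_mul (ψ := fun t : ℝ => 2 * (iteratedDeriv (n + 1) G ((t:ℂ) ^ 2)).re)
      (fun x => by have := han x; fun_prop) h1
    have h3 := noCrit_const_mul (fun x => by have := han x; fun_prop) h2 (a := 2⁻¹) (by norm_num)
    convert h3 using 2 with t
    ring

/-- One step of the sign alternation at the origin: `H(γₙ)` at the critical point `0` of the
even function `γₙ` gives `Re G^{(n)}(0) · Re G^{(n+1)}(0) < 0`. [cite: KiKim2000, (4.12)] -/
theorem re_iteratedDeriv_zero_mul_succ_neg_step {G : ℂ → ℂ} (hG : Differentiable ℂ G)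
    (hH : HasNoFourierCriticalPoint (fun s : ℝ => (G ((s:ℂ) ^ 2)).re)) (n : ℕ)
    (h0 : (iteratedDeriv n G 0).re ≠ 0) :
    (iteratedDeriv n G 0).re * (iteratedDeriv (n + 1) G 0).re < 0 := by
  have h := noCrit_gammaChain hG hH n 0 0
  have e0 : iteratedDeriv 0 (fun s : ℝ => (iteratedDeriv n G ((s:ℂ) ^ 2)).re) 0 = (iteratedDeriv n G 0).re := by
    simp
  have hd1 : deriv (fun s : ℝ => (iteratedDeriv n G ((s:ℂ) ^ 2)).re) =
      fun t : ℝ => 2 * t * (iteratedDeriv (n + 1) G ((t:ℂ) ^ 2)).re :=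
    funext fun t => (hasDerivAt_gammaChain hG n t).deriv
  have e1 : iteratedDeriv 1 (fun s : ℝ => (iteratedDeriv n G ((s:ℂ) ^ 2)).re) 0 = 0 := by
    rw [iteratedDeriv_one, hd1]; simp
  have e2 : iteratedDeriv 2 (fun s : ℝ => (iteratedDeriv n G ((s:ℂ) ^ 2)).re) 0 =
      2 * (iteratedDeriv (n + 1) G 0).re := by
    rw [iteratedDeriv_succ, iteratedDeriv_one, hd1]
    have hd := (((hasDerivAt_id (0:ℝ)).const_mul (2:ℝ)).mul (hasDerivAt_gammaChain hG (n + 1) 0)).deriv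
    rw [show (fun t : ℝ => 2 * t * (iteratedDeriv (n + 1) G ((t:ℂ) ^ 2)).re) =
      ((fun y : ℝ => 2 * id y) * fun s : ℝ => (iteratedDeriv (n + 1) G ((s:ℂ) ^ 2)).re) from rfl, hd]
    simp
  rw [e0, e1, e2] at h
  have := h rfl h0
  nlinarith

/-- From `H` of all `γₙ`: the derivatives of `G` at the origin alternate strictly in sign (and
none vanishes). [cite: KiKim2000, (4.12)] -/
theorem re_iteratedDeriv_zero_mul_succ_neg {G : ℂ → ℂ} (hG : Differentiable ℂ G) (hG0 : (G 0).re ≠ 0)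
    (hH : HasNoFourierCriticalPoint (fun s : ℝ => (G ((s:ℂ) ^ 2)).re)) (n : ℕ) :
    (iteratedDeriv n G 0).re ≠ 0 ∧ (iteratedDeriv n G 0).re * (iteratedDeriv (n + 1) G 0).re < 0 := by
  induction n with
  | zero =>
    have h0 : (iteratedDeriv 0 G 0).re ≠ 0 := by simpa using hG0
    exact ⟨h0, re_iteratedDeriv_zero_mul_succ_neg_step hG hH 0 h0⟩
  | succ n ih =>
    obtain ⟨_, ihlt⟩ := ih
    have hn1 : (iteratedDeriv (n + 1) G 0).re ≠ 0 := by
      intro h0; rw [h0, mul_zero] at ihlt; exact lt_irrefl _ ihlt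
    exact ⟨hn1, re_iteratedDeriv_zero_mul_succ_neg_step hG hH (n + 1) hn1⟩

/-- `(F^{(k)})^{(n)} = F^{(k+n)}` for functions on `ℂ`. [folklore] -/
theorem iteratedDeriv_iteratedDeriv_complex (F : ℂ → ℂ) (k n : ℕ) :
    iteratedDeriv n (iteratedDeriv k F) = iteratedDeriv (k + n) F := by
  induction n with
  | zero => simp
  | succ n ih => rw [iteratedDeriv_succ, ih, ← iteratedDeriv_succ]; rfl

/-- On the negative axis no derivative of `G` vanishes: Taylor expansion at the origin with
terms of one sign. [cite: KiKim2000, Theorem 4.3 (proof, p. 64: "`G^{(m)}` has no zeros in `(-∞, 0]`")] -/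
theorem re_iteratedDeriv_ne_zero_of_neg {G : ℂ → ℂ} (hG : Differentiable ℂ G) (hreal : ∀ x : ℝ, (G x).im = 0)
    (halt : ∀ n, (iteratedDeriv n G 0).re ≠ 0 ∧ (iteratedDeriv n G 0).re * (iteratedDeriv (n + 1) G 0).re < 0)
    (k : ℕ) {x : ℝ} (hx : x < 0) : (iteratedDeriv k G x).re ≠ 0 := by
  have hD : Differentiable ℂ (iteratedDeriv k G) := differentiable_iteratedDeriv hG k
  have hT := Complex.hasSum_re (Complex.hasSum_taylorSeries_of_entire hD 0 x)
  -- the terms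
  set a : ℕ → ℝ := fun n => (iteratedDeriv (k + n) G 0).re with ha
  have hterm : ∀ n, ((n.factorial : ℂ)⁻¹ • ((x:ℂ) - 0) ^ n • iteratedDeriv n (iteratedDeriv k G) 0).re =
      (n.factorial : ℝ)⁻¹ * x ^ n * a n := by
    intro n
    rw [iteratedDeriv_iteratedDeriv_complex, sub_zero, smul_eq_mul, smul_eq_mul]
    have him : (iteratedDeriv (k + n) G 0).im = 0 := by
      simpa using im_iteratedDeriv_ofReal_eq_zero hG hreal (k + n) 0
    rw [show ((n.factorial : ℂ))⁻¹ * ((x:ℂ) ^ n * iteratedDeriv (k + n) G 0) =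
      (((n.factorial : ℝ)⁻¹ * x ^ n : ℝ) : ℂ) * iteratedDeriv (k + n) G 0 by push_cast; ring,
      Complex.re_ofReal_mul, ha]
  simp only [hterm] at hT
  -- signs: `a (n+1)` has the sign opposite to `a n`, so `x^n a n` has the sign of `a 0`
  have hsgn : ∀ n, 0 < a 0 * (x ^ n * a n) := by
    intro n
    induction n with
    | zero =>
      have : a 0 ≠ 0 := by simpa [ha] using (halt k).1
      simpa using mul_self_pos.mpr this
    | succ n ih =>
      have h1 := (halt (k + n)).2
      rw [show k + n + 1 = k + (n + 1) by ring] at h1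
      have h2 : x ^ (n + 1) * a (n + 1) = (x ^ n * a n) * (x * a (n + 1) / a n) := by
        have : a n ≠ 0 := (halt (k + n)).1
        field_simp
        ring
      -- `x < 0` and `a n a (n+1) < 0` give `x a(n+1)/a(n) > 0`
      have h3 : 0 < x * a (n + 1) / a n := by
        have han : a n ≠ 0 := (halt (k + n)).1
        have : x * a (n + 1) / a n = x * (a n * a (n + 1)) / (a n * a n) := by
          field_simp
        rw [this]
        apply div_pos
        · nlinarith
        · exact mul_self_pos.mpr han
      rw [h2, ← mul_assoc]
      exact mul_pos ih h3
  -- the sum is `≥` its first term in the direction of `a 0`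
  intro h0
  rw [h0] at hT
  have hT' : HasSum (fun n => a 0 * ((n.factorial : ℝ)⁻¹ * x ^ n * a n)) 0 := by
    simpa using hT.mul_left (a 0)
  have hle := le_hasSum hT' 0 (fun n _ => by
    have := hsgn n
    have hf : (0:ℝ) < (n.factorial : ℝ)⁻¹ := by positivity
    nlinarith)
  simp only [Nat.factorial_zero, Nat.cast_one, inv_one, pow_zero, one_mul] at hle
  have ha0 : a 0 ≠ 0 := by simpa [ha] using (halt k).1
  exact absurd hle (not_le.mpr (mul_self_pos.mpr ha0))

end reduction

section mainTheorem

open _root_.Complex Literature.Analysis.TotalPositivity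
open scoped ComplexConjugate

/-- `H(Re G|ℝ)` from `H` of the chain `γₙ` (Ki–Kim 2000, p. 64: a critical zero of `G^{(N)}` at
`c > 0` would give one of `g_{N-1}(x) = G^{(N-1)}(x²)` at `√c`; on `(-∞, 0]` no `G^{(m)}` vanishes
by (4.12)). [cite: KiKim2000, Theorem 4.3 (proof, p. 64)] -/
theorem noCrit_re_of_gammaChain {G : ℂ → ℂ} (hG : Differentiable ℂ G) (hreal : ∀ x : ℝ, (G x).im = 0)
    (hG0 : (G 0).re ≠ 0) (hH : HasNoFourierCriticalPoint (fun s : ℝ => (G ((s:ℂ) ^ 2)).re)) :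
    HasNoFourierCriticalPoint (fun t : ℝ => (G t).re) := by
  have halt := re_iteratedDeriv_zero_mul_succ_neg hG hG0 hH
  intro n c hc1 hc0
  simp only [iteratedDeriv_re_ofReal hG] at hc1 hc0 ⊢
  rcases lt_trichotomy c 0 with hc | hc | hc
  · exact absurd hc1 (re_iteratedDeriv_ne_zero_of_neg hG hreal halt (n + 1) hc)
  · subst hc
    exact absurd hc1 (by simpa using (halt (n + 1)).1)
  · set s := Real.sqrt c with hs
    have hs2 : ((s:ℂ)) ^ 2 = (c:ℂ) := by rw [← Complex.ofReal_pow, hs, Real.sq_sqrt hc.le]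
    have hss : s * s = c := by rw [hs, Real.mul_self_sqrt hc.le]
    have h := noCrit_gammaChain hG hH n 0 s
    have hd1 : deriv (fun t : ℝ => (iteratedDeriv n G ((t:ℂ) ^ 2)).re) =
        fun t : ℝ => 2 * t * (iteratedDeriv (n + 1) G ((t:ℂ) ^ 2)).re :=
      funext fun t => (hasDerivAt_gammaChain hG n t).deriv
    have e0 : iteratedDeriv 0 (fun t : ℝ => (iteratedDeriv n G ((t:ℂ) ^ 2)).re) s = (iteratedDeriv n G c).re := by
      simp [hs2]
    have e1 : iteratedDeriv 1 (fun t : ℝ => (iteratedDeriv n G ((t:ℂ) ^ 2)).re) s = 0 := by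
      rw [iteratedDeriv_one, hd1]
      simp only [hs2]
      rw [hc1]; ring
    have e2 : iteratedDeriv 2 (fun t : ℝ => (iteratedDeriv n G ((t:ℂ) ^ 2)).re) s =
        4 * c * (iteratedDeriv (n + 2) G c).re := by
      rw [iteratedDeriv_succ, iteratedDeriv_one, hd1]
      have hd := (((hasDerivAt_id s).const_mul (2:ℝ)).mul (hasDerivAt_gammaChain hG (n + 1) s)).deriv
      rw [show (fun t : ℝ => 2 * t * (iteratedDeriv (n + 1) G ((t:ℂ) ^ 2)).re) =
        ((fun y : ℝ => 2 * id y) * fun t : ℝ => (iteratedDeriv (n + 1) G ((t:ℂ) ^ 2)).re) from rfl, hd]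
      simp only [hs2, id, hc1, mul_zero, zero_add, show n + 1 + 1 = n + 2 by ring]
      rw [← hss]; ring
    have key := h (by rw [zero_add, e1]) (by rw [e0]; exact hc0)
    rw [e0, show (0:ℕ) + 2 = 2 from rfl, e2] at key
    -- `reₙ · (4 c reₙ₊₂) < 0` with `c > 0`
    by_contra hcon
    push Not at hcon
    have : 0 ≤ (iteratedDeriv n G ↑c).re * (4 * c * (iteratedDeriv (n + 2) G ↑c).re) := by
      have : (iteratedDeriv n G ↑c).re * (4 * c * (iteratedDeriv (n + 2) G ↑c).re) =
        (4 * c) * ((iteratedDeriv n G ↑c).re * (iteratedDeriv (n + 2) G ↑c).re) := by ring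
      rw [this]; positivity
    linarith

/-- Growth of the quotient `f₁ = f/z^m`: still `≤ C₁ exp (‖z‖^ρ')` with `0 ≤ ρ' = max ρ 0`. [folklore] -/
theorem exists_growth_of_eq_pow_mul {f f₁ : ℂ → ℂ} (hf₁ : Differentiable ℂ f₁) {m : ℕ} {ρ C : ℝ}
    (hfac : ∀ z, f z = z ^ m * f₁ z) (hgr : ∀ z, ‖f z‖ ≤ C * Real.exp (‖z‖ ^ ρ)) :
    ∃ C₁ : ℝ, 0 ≤ C₁ ∧ ∀ z, ‖f₁ z‖ ≤ C₁ * Real.exp (‖z‖ ^ max ρ 0) := by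
  obtain ⟨M₀, hM₀⟩ := (isCompact_closedBall (0 : ℂ) 1).exists_bound_of_continuousOn
    hf₁.continuous.continuousOn
  have hM : 0 ≤ M₀ := (norm_nonneg _).trans (hM₀ 0 (by simp))
  refine ⟨max |C| M₀, le_trans hM (le_max_right _ _), fun z => ?_⟩
  by_cases hz : ‖z‖ ≤ 1
  · calc ‖f₁ z‖ ≤ M₀ := hM₀ z (Metric.mem_closedBall.mpr (by simpa using hz))
      _ ≤ M₀ * Real.exp (‖z‖ ^ max ρ 0) := by
          have : 1 ≤ Real.exp (‖z‖ ^ max ρ 0) := Real.one_le_exp (by positivity)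
          nlinarith
      _ ≤ max |C| M₀ * Real.exp (‖z‖ ^ max ρ 0) := by gcongr; exact le_max_right _ _
  · rw [not_le] at hz
    have hzm : 1 ≤ ‖z‖ ^ m := one_le_pow₀ hz.le
    have h1 : ‖f₁ z‖ ≤ ‖f z‖ := by
      rw [hfac z, norm_mul, norm_pow]
      calc ‖f₁ z‖ = 1 * ‖f₁ z‖ := by ring
        _ ≤ ‖z‖ ^ m * ‖f₁ z‖ := by gcongr
    calc ‖f₁ z‖ ≤ ‖f z‖ := h1
      _ ≤ C * Real.exp (‖z‖ ^ ρ) := hgr z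
      _ ≤ |C| * Real.exp (‖z‖ ^ ρ) := by gcongr; exact le_abs_self C
      _ ≤ |C| * Real.exp (‖z‖ ^ max ρ 0) := by
          apply mul_le_mul_of_nonneg_left _ (abs_nonneg C)
          exact Real.exp_le_exp.mpr (Real.rpow_le_rpow_of_exponent_le hz.le (le_max_left _ _))
      _ ≤ max |C| M₀ * Real.exp (‖z‖ ^ max ρ 0) := by gcongr; exact le_max_left _ _

/-- **Ki–Kim 2000, Theorem 4.3 — the case of no critical points, `α = 0`, even `f` — holds.**
An even real entire function of order `< 2` whose real restriction has no Fourier critical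
point has only real zeros. Proof: the reduction `f(z) = z^m f₁(z)`, `f₁ = G(z²)` of the printed
proof (pp. 63–65; division by `x` is Thm 3.2's Corollary, `noCrit_of_noCrit_pow_mul`; the
transfer of `H` along `gₙ(x) = G^{(n)}(x²)`, `g_{n-1}' = 2x gₙ`, is `noCrit_gammaChain`), then the
Fourier–Pólya theorem for the order-`< 1` function `G` (`im_eq_zero_of_noCrit_of_order_lt_one`,
Thm 4.1 with `K = 0`) and the absence of zeros of `G` on `(-∞, 0)` ((4.12),
`re_iteratedDeriv_ne_zero_of_neg`). [cite: KiKim2000, Theorem 4.3] -/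
theorem _root_.Literature.Analysis.Complex.KiKim2000_thm_4_3_noCriticalPoints_holds :
    KiKim2000_thm_4_3_noCriticalPoints := by
  intro f hf hne hreal heven _hsum hH z hz
  obtain ⟨hd, ρ, C, hρ, hgr⟩ := hf
  /- Step 0: divide out the zero at the origin. -/
  obtain ⟨m, f₁, hf₁d, hf₁0, hfac⟩ := exists_eq_pow_mul_of_entire hd hne
  have hf₁real : ∀ x : ℝ, (f₁ x).im = 0 :=
    im_eq_zero_of_mul (D := fun z : ℂ => z ^ m) (differentiable_pow m) hf₁d (z₁ := 1) (by simp)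
      (fun x => by rw [← Complex.ofReal_pow]; exact Complex.ofReal_im _)
      (fun x => by rw [← hfac]; exact hreal x)
  have hf₁even : ∀ z, f₁ (-z) = f₁ z := by
    -- `(-z)^m f₁(-z) = z^m f₁(z)`; at `z → 0` this forces `(-1)^m = 1`
    have h1 : ∀ z, (-1 : ℂ) ^ m * f₁ (-z) = f₁ z ∨ z = 0 := by
      intro z
      by_cases hz0 : z = 0
      · exact Or.inr hz0
      · left
        have := hfac (-z)
        rw [heven, hfac z, neg_pow] at this
        have h2 : z ^ m * f₁ z = z ^ m * ((-1) ^ m * f₁ (-z)) := by rw [this]; ring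
        exact (mul_left_cancel₀ (pow_ne_zero m hz0) h2).symm
    have hsgn : (-1 : ℂ) ^ m = 1 := by
      -- by continuity at `0`
      have hc1 : Continuous fun z : ℂ => (-1 : ℂ) ^ m * f₁ (-z) :=
        continuous_const.mul (hf₁d.continuous.comp continuous_neg)
      have hc2 : Continuous f₁ := hf₁d.continuous
      have heq : (fun z : ℂ => (-1 : ℂ) ^ m * f₁ (-z)) = f₁ := by
        apply Continuous.ext_on (dense_compl_singleton (0:ℂ)) hc1 hc2
        intro z hz
        exact ((h1 z).resolve_right hz)
      have := congr_fun heq 0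
      simp only [neg_zero] at this
      exact mul_left_eq_self₀.mp this |>.resolve_right hf₁0
    intro z
    rcases h1 z with h | h
    · rw [hsgn, one_mul] at h; exact h
    · subst h; simp
  obtain ⟨C₁, hC₁, hgr₁⟩ := exists_growth_of_eq_pow_mul hf₁d hfac hgr
  have hρ' : max ρ 0 < 2 := max_lt hρ two_pos
  have hH₁ : HasNoFourierCriticalPoint (fun t : ℝ => (f₁ t).re) := by
    refine noCrit_of_noCrit_pow_mul (analyticAt_re_ofReal hf₁d) m ?_
    convert hH using 2 with t
    rw [hfac, ← Complex.ofReal_pow, Complex.re_ofReal_mul]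
  -- the zero `z`
  by_cases hz0 : z = 0
  · simp [hz0]
  have hz₁ : f₁ z = 0 := by
    have := hfac z
    rw [hz] at this
    exact (mul_eq_zero.mp this.symm).resolve_left (pow_ne_zero m hz0)
  /- Step 1: the function `G` with `G(z²) = f₁(z)`. -/
  obtain ⟨hGd, hGsq⟩ := differentiable_comp_cpow_half hf₁d hf₁even
  set G : ℂ → ℂ := fun w => f₁ (w ^ ((2:ℂ)⁻¹)) with hGdef
  have hG1 : IsEntireOfOrderLt 1 G := by
    refine ⟨hGd, max ρ 0 / 2, C₁, by linarith, fun w => ?_⟩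
    calc ‖G w‖ = ‖f₁ (w ^ ((2:ℂ)⁻¹))‖ := rfl
      _ ≤ C₁ * Real.exp (‖w ^ ((2:ℂ)⁻¹)‖ ^ max ρ 0) := hgr₁ _
      _ = C₁ * Real.exp (‖w‖ ^ (max ρ 0 / 2)) := by
          rw [norm_cpow_half, ← Real.rpow_mul (norm_nonneg _)]
          congr 2; ring
  have hGreal : ∀ x : ℝ, (G x).im = 0 := by
    intro x
    have h1 : conj ((x:ℂ) ^ ((2:ℂ)⁻¹)) ^ 2 = ((x:ℂ) ^ ((2:ℂ)⁻¹)) ^ 2 := by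
      rw [← map_pow, cpow_half_sq, Complex.conj_ofReal]
    have h2 := even_apply_eq_of_sq_eq hf₁even h1
    rw [apply_conj_eq_conj hf₁d hf₁real] at h2
    exact Complex.conj_eq_iff_im.mp h2
  have hG0 : G 0 = f₁ 0 := by
    simp only [hGdef]
    rw [Complex.zero_cpow (inv_ne_zero two_ne_zero)]
  have hHγ : HasNoFourierCriticalPoint (fun s : ℝ => (G ((s:ℂ) ^ 2)).re) := by
    convert hH₁ using 2 with t
    exact congrArg Complex.re (hGsq t)
  have hG0re : (G 0).re ≠ 0 := by
    rw [hG0]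
    intro h0
    exact hf₁0 (Complex.ext (by simpa using h0) (by simpa using hf₁real 0))
  have hHG : HasNoFourierCriticalPoint (fun t : ℝ => (G t).re) := noCrit_re_of_gammaChain hGd hGreal hG0re hHγ
  /- Step 2: the zeros of `G` are real … -/
  have hzsq : G (z ^ 2) = 0 := by rw [hGsq]; exact hz₁
  have him2 : (z ^ 2).im = 0 :=
    im_eq_zero_of_noCrit_of_order_lt_one hG1 (by rw [hG0]; exact hf₁0) hGreal hHG (z ^ 2) hzsq
  /- … and non-negative. -/
  have hre2 : 0 ≤ (z ^ 2).re := by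
    by_contra hneg
    push Not at hneg
    have halt := re_iteratedDeriv_zero_mul_succ_neg hGd hG0re hHγ
    have h1 := re_iteratedDeriv_ne_zero_of_neg hGd hGreal halt 0 hneg
    have h2 : z ^ 2 = (((z ^ 2).re : ℝ) : ℂ) := Complex.ext (by simp) (by simpa using him2)
    rw [h2] at hzsq
    simp only [iteratedDeriv_zero] at h1
    exact h1 (by rw [hzsq]; simp)
  /- Step 3: `z² ≥ 0` real forces `z` real. -/
  have him : (z ^ 2).im = 2 * z.re * z.im := by simp [sq, Complex.mul_im]; ring
  have hre : (z ^ 2).re = z.re * z.re - z.im * z.im := by simp [sq, Complex.mul_re]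
  rw [him] at him2
  rw [hre] at hre2
  by_contra hzim
  have hzre : z.re = 0 := by
    rcases mul_eq_zero.mp him2 with h | h
    · rcases mul_eq_zero.mp h with h' | h'
      · norm_num at h'
      · exact h'
    · exact absurd h hzim
  rw [hzre] at hre2
  have : 0 < z.im * z.im := mul_self_pos.mpr hzim
  linarith

end mainTheorem

end KiKim
end Literature.Analysis.Complex
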